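import Summits.BirchSwinnertonDyer.BirchSwinnertonDyer.Theorems.CMKolyvaginAtInertTwoCMKolyvaginConjectureAtInertTwoPositiveDepthPrimeLevel
import HarnessLib

/-!
# Crux `CMKolyvaginConjectureAtInertTwo` (stmt-BirchSwinnertonDyer-24648), open stub `stub_positiveDepth`:
# AT A CM-INERT KOLYVAGIN PRIME, `P(ℓ) mod 2E(K[ℓ])` DOES NOT DEPEND ON THE KOLYVAGIN DATUM

Route `CMKolyvaginAtInertTwo` (cell `pub/bsd-eis`, seat `leafhand-bsd-cmkolyvaginatinert-1` g0); helper (`--supports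
stmt-BirchSwinnertonDyer-24648 --as helper`). THEOREMS ONLY (no definition, no named fact, no `sorry`); closes nothing;
BSD is proved for no curve. Sequel of `…PositiveDepthPrimeLevel.lean` (p794939).

WHAT. The stub quantifies `∃ d : KolyvaginHeegnerData Dt β ι n` — the datum CHOOSES `y(n)` (pinned by `map_y`), the
generators `σ_ℓ` of `G_ℓ` and the transversal `S` of `G_n` in `𝒢_n` (Gross 1991 §§3–4: *"the class `[P_n]` is
independent of the choice of `S`"*). At a prime level `ℓ` which is a Zhang–Kolyvagin prime at `2` inert in `F`, on a
frame of the stub (CM, odd `d_K ≠ −3`, Heegner for `N_E`), this file PROVES that the `2`-divisibility of `P(ℓ)` in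
`E(K[ℓ])` is the same for ALL data:

* `halfTrace_eq_of_zpowers_eq` — the half-trace `Σ_{k<(ℓ+1)/2} σ^{2k} y` depends only on the subgroup `⟨σ²⟩` (the
  squares of `G_ℓ`), not on the generator `σ`;
* `two_dvd_sum_transversal_iff` — two transversals `S, S'` of `G_ℓ = ⟨σ⟩` in `𝒢_ℓ` give sums
  `Σ_{s∈S} s(A)`, `Σ_{s'∈S'} s'(A)` that agree modulo `2E(K[ℓ])` whenever `σA = −A` (matching representatives differ by
  a power of `σ`, which acts on `A` by `±1`);
* **`two_dvd_derivedPoint_iff_of_data`** — for any two data `d, d'` of conductor `ℓ`: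
  `P_d(ℓ) ∈ 2E(K[ℓ]) ⟺ P_{d'}(ℓ) ∈ 2E(K[ℓ])` (via p794939's `two_dvd_derivedPoint_iff_two_dvd_halfTrace` and
  `pointGalHom_σ_halfTrace_eq_neg`). Hence at prime level the stub's `∃ d` may be read `∀ d` (data exist:
  `nonempty_kolyvaginHeegnerData_of_kolyvaginPrimes`): `exists_iff_forall_primitive_prime`.

HONEST FRAMING: elementary group bookkeeping over tree theorems; the open mathematics (Kolyvagin non-vanishing at `2`)
is untouched. [cite: GrossLMS1991, §3 (3.5), §4 (4.1) and the remark after (4.1)] [cite: WZhang2014, §3.7]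
-/

set_option linter.dupNamespace false -- `Summit.BirchSwinnertonDyer.BirchSwinnertonDyer.Theorems.…` (summit = sub)
set_option autoImplicit false

noncomputable section

open scoped Classical

namespace Summit.BirchSwinnertonDyer.BirchSwinnertonDyer.Theorems.CMKolyvaginConjecturePositiveDepth

open Finset WeierstrassCurve NumberField
open Literature.NumberTheory.EllipticCurves Literature.NumberTheory.EllipticCurves.ModularForms
open Literature.NumberTheory.EllipticCurves.Rank1Residual
open Summit.BirchSwinnertonDyer.BirchSwinnertonDyer.Theorems

section Algebra

variable {G : Type*} [Group G] {A : Type*} [AddCommGroup A] (ρ : G →* AddMonoid.End A)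

/-- `Σᶠ` over the cyclic group `⟨x⟩` of order `k` is the sum over the powers `x^0, …, x^{k−1}`. [folklore] -/
private theorem finsum_mem_zpowers_eq_sum_range'' {M : Type*} [AddCommMonoid M]
    (x : G) {k : ℕ} (hk : orderOf x = k) (hk0 : k ≠ 0) (f : G → M) :
    ∑ᶠ g ∈ (Subgroup.zpowers x : Set G), f g = ∑ i ∈ Finset.range k, f (x ^ i) := by
  classical
  have hfin : IsOfFinOrder x := orderOf_pos_iff.mp (by omega)
  have hset : (Subgroup.zpowers x : Set G) = ↑((Finset.range k).image (x ^ ·)) := by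
    ext g
    rw [SetLike.mem_coe, hfin.mem_zpowers_iff_mem_range_orderOf, hk, Finset.mem_coe]
  rw [hset, finsum_mem_coe_finset, Finset.sum_image]
  intro i hi j hj hij
  exact pow_injOn_Iio_orderOf (Set.mem_Iio.mpr (hk ▸ Finset.mem_range.mp hi))
    (Set.mem_Iio.mpr (hk ▸ Finset.mem_range.mp hj)) hij

/-- **The half-trace depends only on `⟨σ²⟩`**: if `σ, σ'` have the same even order `2h` and generate the same cyclic
group, then `Σ_{k<h} ρ(σ'^{2k}) y = Σ_{k<h} ρ(σ^{2k}) y` (both are the sum over the subgroup of squares). [folklore] -/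
theorem halfTrace_eq_of_zpowers_eq (σ σ' : G) {h : ℕ} (hh : h ≠ 0) (hσ : orderOf σ = 2 * h)
    (hσ' : orderOf σ' = 2 * h) (hz : Subgroup.zpowers σ' = Subgroup.zpowers σ) (y : A) :
    ∑ k ∈ range h, ρ ((σ' ^ 2) ^ k) y = ∑ k ∈ range h, ρ ((σ ^ 2) ^ k) y := by
  have hord : ∀ τ : G, orderOf τ = 2 * h → orderOf (τ ^ 2) = h := fun τ hτ ↦ by
    rw [orderOf_pow' τ two_ne_zero, hτ, Nat.gcd_mul_right_left, Nat.mul_div_cancel_left h two_pos]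
  have hsq : ∀ τ τ' : G, Subgroup.zpowers τ' = Subgroup.zpowers τ →
      Subgroup.zpowers (τ' ^ 2) ≤ Subgroup.zpowers (τ ^ 2) := fun τ τ' hττ' ↦ by
    rw [Subgroup.zpowers_le]
    have hmem : τ' ∈ Subgroup.zpowers τ := hττ' ▸ Subgroup.mem_zpowers τ'
    obtain ⟨j, hj⟩ := Subgroup.mem_zpowers_iff.mp hmem
    have hpow : (τ ^ j) ^ 2 = (τ ^ 2) ^ j := by
      rw [← zpow_natCast (τ ^ j) 2, ← zpow_mul, mul_comm j, zpow_mul, zpow_natCast]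
    rw [← hj, hpow]
    exact Subgroup.zpow_mem_zpowers _ _
  have heq : Subgroup.zpowers (σ' ^ 2) = Subgroup.zpowers (σ ^ 2) :=
    le_antisymm (hsq σ σ' hz) (hsq σ' σ hz.symm)
  rw [← finsum_mem_zpowers_eq_sum_range'' (σ' ^ 2) (hord σ' hσ') hh (fun g ↦ ρ g y),
    ← finsum_mem_zpowers_eq_sum_range'' (σ ^ 2) (hord σ hσ) hh (fun g ↦ ρ g y), heq]

/-- `σ^i A = (−1)^i A` when `σA = −A`. [folklore] -/
theorem pow_smul_eq_neg_one_pow_of_eq_neg (σ : G) (a : A) (ha : ρ σ a = -a) (i : ℕ) :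
    ρ (σ ^ i) a = ((-1 : ℤ) ^ i) • a := by
  induction i with
  | zero => simp
  | succ i ih =>
    rw [pow_succ', map_mul]
    change ρ σ (ρ (σ ^ i) a) = _
    rw [ih, map_zsmul, ha, smul_neg, pow_succ, mul_neg_one, neg_smul]

/-- **Two transversals give the same sum modulo `2`**: let `H = ⟨σ⟩ ≤ 𝒢` with `σ` of finite order and `σA = −A`;
if `S, S' ⊆ 𝒢` are both systems of representatives of `𝒢/H` (`∀ g ∈ 𝒢, ∃! s ∈ S, g⁻¹ s ∈ H`), then
`Σ_{s∈S} s(A) ∈ 2A' ⟺ Σ_{s'∈S'} s'(A) ∈ 2A'`. [cite: GrossLMS1991, §4 (remark after (4.1): [P_n] is independent of S)] -/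
theorem two_dvd_sum_transversal_iff (𝒢 : Subgroup G) (σ : G) (hfin : IsOfFinOrder σ) (a : A) (ha : ρ σ a = -a)
    (S S' : Finset G) (hS : ∀ s ∈ S, s ∈ 𝒢) (hS' : ∀ s ∈ S', s ∈ 𝒢)
    (hT : ∀ g ∈ 𝒢, ∃! s, s ∈ S ∧ g⁻¹ * s ∈ Subgroup.zpowers σ)
    (hT' : ∀ g ∈ 𝒢, ∃! s, s ∈ S' ∧ g⁻¹ * s ∈ Subgroup.zpowers σ) :
    (∃ Q : A, (2 : ℤ) • Q = ∑ s ∈ S, ρ s a) ↔ ∃ Q : A, (2 : ℤ) • Q = ∑ s ∈ S', ρ s a := by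
  -- the matching `φ : S' → S`, `ψ : S → S'`
  have hex : ∀ s' ∈ S', ∃ s, s ∈ S ∧ s'⁻¹ * s ∈ Subgroup.zpowers σ := fun s' hs' ↦ (hT s' (hS' s' hs')).exists
  have hex' : ∀ s ∈ S, ∃ s', s' ∈ S' ∧ s⁻¹ * s' ∈ Subgroup.zpowers σ := fun s hs ↦ (hT' s (hS s hs)).exists
  choose! φ hφS hφH using hex
  choose! ψ hψS hψH using hex'
  have hH : ∀ {x y z : G}, x⁻¹ * y ∈ Subgroup.zpowers σ → y⁻¹ * z ∈ Subgroup.zpowers σ →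
      x⁻¹ * z ∈ Subgroup.zpowers σ := fun {x y z} h1 h2 ↦ by
    have := Subgroup.mul_mem _ h1 h2
    rwa [mul_assoc, mul_inv_cancel_left] at this
  have hψφ : ∀ s' ∈ S', ψ (φ s') = s' := fun s' hs' ↦ by
    have h1 : s'⁻¹ * ψ (φ s') ∈ Subgroup.zpowers σ := hH (hφH s' hs') (hψH _ (hφS s' hs'))
    have h2 : s'⁻¹ * s' ∈ Subgroup.zpowers σ := by rw [inv_mul_cancel]; exact Subgroup.one_mem _
    exact (hT' s' (hS' s' hs')).unique ⟨hψS _ (hφS s' hs'), h1⟩ ⟨hs', h2⟩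
  have hφψ : ∀ s ∈ S, φ (ψ s) = s := fun s hs ↦ by
    have h1 : s⁻¹ * φ (ψ s) ∈ Subgroup.zpowers σ := hH (hψH s hs) (hφH _ (hψS s hs))
    have h2 : s⁻¹ * s ∈ Subgroup.zpowers σ := by rw [inv_mul_cancel]; exact Subgroup.one_mem _
    exact (hT s (hS s hs)).unique ⟨hφS _ (hψS s hs), h1⟩ ⟨hs, h2⟩
  -- reindex the `S`-sum along `φ`
  have hre : ∑ s ∈ S, ρ s a = ∑ s' ∈ S', ρ (φ s') a :=
    (Finset.sum_nbij' φ ψ hφS hψS hψφ hφψ (fun _ _ ↦ rfl)).symm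
  -- each `φ s' = s' σ^i` acts on `a` as `± s'`
  have hterm : ∀ s' ∈ S', ∃ t : A, ρ (φ s') a - ρ s' a = (2 : ℤ) • t := fun s' hs' ↦ by
    obtain ⟨i, -, hi⟩ : ∃ i ∈ Finset.range (orderOf σ), σ ^ i = s'⁻¹ * φ s' := by
      simpa [Finset.mem_image] using (hfin.mem_zpowers_iff_mem_range_orderOf).mp (hφH s' hs')
    have hφeq : φ s' = s' * σ ^ i := by rw [hi, mul_inv_cancel_left]
    rw [hφeq, map_mul]
    show ∃ t : A, ρ s' (ρ (σ ^ i) a) - ρ s' a = (2 : ℤ) • t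
    rw [pow_smul_eq_neg_one_pow_of_eq_neg ρ σ a ha i, map_zsmul]
    rcases neg_one_pow_eq_or ℤ i with h | h <;> rw [h]
    · exact ⟨0, by simp⟩
    · exact ⟨-ρ s' a, by rw [neg_one_smul, smul_neg, two_smul]; abel⟩
  choose! t ht using hterm
  have hdiff : ∑ s ∈ S, ρ s a = ∑ s' ∈ S', ρ s' a + (2 : ℤ) • ∑ s' ∈ S', t s' := by
    rw [hre, Finset.smul_sum, ← Finset.sum_add_distrib]
    exact Finset.sum_congr rfl fun s' hs' ↦ by rw [← ht s' hs']; abel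
  constructor
  · rintro ⟨Q, hQ⟩
    exact ⟨Q - ∑ s' ∈ S', t s', by rw [smul_sub, hQ, hdiff]; abel⟩
  · rintro ⟨Q, hQ⟩
    exact ⟨Q + ∑ s' ∈ S', t s', by rw [smul_add, hQ, hdiff]⟩

end Algebra

section Heegner

variable {K : Type} [Field K] [NumberField K]

/-- **At a CM-inert Kolyvagin prime, the `2`-divisibility of `P(ℓ)` does not depend on the Kolyvagin datum.** For
`W/ℚ` globally minimal with CM, `K` imaginary quadratic with odd `d_K ≠ −3` and Heegner for `N_E`, `ℓ` a Zhang–Kolyvagin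
prime at `2` inert in `F`, and ANY two data `d, d'` of conductor `ℓ` on the frame `(Dt, β, ι)`:
`P_d(ℓ) ∈ 2E(K[ℓ]) ⟺ P_{d'}(ℓ) ∈ 2E(K[ℓ])`. (`y(ℓ)` is pinned by `map_y`; the half-trace sees only `⟨σ_ℓ²⟩`; the two
transversals are matched through `G_ℓ = ⟨σ_ℓ⟩`, which acts on the half-trace by `±1`.)
[cite: GrossLMS1991, §4 (4.1) and the remark that [P_n] is independent of S] [cite: WZhang2014, §3.7] -/
theorem two_dvd_derivedPoint_iff_of_data (W : WeierstrassCurve ℚ) [W.IsElliptic] [W.IsGloballyMinimal]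
    [NeZero (W.conductorNorm ℤ)] (hCM : W.HasCM) (hK : IsImaginaryQuadratic K)
    (hodd : Odd (NumberField.discr K)) (h3 : NumberField.discr K ≠ -3)
    (hH : SatisfiesHeegnerHypothesis (W.conductorNorm ℤ) K)
    {Dt : ModularParametrizationData W (W.conductorNorm ℤ)} {β : ℤ} {ι : K →+* ℂ} {ℓ : ℕ}
    (hℓK : Zhang2014.IsKolyvaginPrime (W.conductorNorm ℤ) W K 2 ℓ) (hℓF : CMInert W ℓ)
    (d d' : KolyvaginHeegnerData Dt β ι ℓ) :
    (∃ Q : (W.baseChange (ringClassField K ι ℓ)).toAffine.Point, (2 : ℤ) • Q = d.derivedPoint) ↔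
      ∃ Q : (W.baseChange (ringClassField K ι ℓ)).toAffine.Point, (2 : ℤ) • Q = d'.derivedPoint := by
  have hℓ := hℓK.1
  have hinert : (Ideal.span {(ℓ : 𝓞 K)}).IsPrime := hℓK.2.2.2.2.1
  have hℓℓ : ℓ ∈ ℓ.primeFactors := Nat.mem_primeFactors.mpr ⟨hℓ, dvd_rfl, hℓ.ne_zero⟩
  rw [two_dvd_derivedPoint_iff_two_dvd_halfTrace W hCM hK hodd h3 hH hℓK hℓF d,
    two_dvd_derivedPoint_iff_two_dvd_halfTrace W hCM hK hodd h3 hH hℓK hℓF d']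
  -- same `y`
  have hy : d'.y = d.y :=
    Affine.Point.map_injective (W' := W) (ringClassField K ι ℓ).subtype.toRatAlgHom (d'.map_y.trans d.map_y.symm)
  -- same half-trace
  have hℓodd : Odd ℓ := hℓ.odd_of_ne_two hℓK.2.2.2.1
  obtain ⟨h, hh⟩ : ∃ h, ℓ + 1 = 2 * h := by obtain ⟨r, hr⟩ := hℓodd; exact ⟨r + 1, by omega⟩
  have hh0 : h ≠ 0 := by omega
  have hdiv : (ℓ + 1) / 2 = h := by omega
  have hz : Subgroup.zpowers (d'.σ ℓ) = Subgroup.zpowers (d.σ ℓ) := by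
    rw [d.zpowers_σ ℓ hℓℓ, d'.zpowers_σ ℓ hℓℓ]
  have hA : ∑ k ∈ range ((ℓ + 1) / 2), pointGalHom W (ringClassField K ι ℓ) ((d'.σ ℓ ^ 2) ^ k) d'.y =
      ∑ k ∈ range ((ℓ + 1) / 2), pointGalHom W (ringClassField K ι ℓ) ((d.σ ℓ ^ 2) ^ k) d.y := by
    rw [hy, hdiv]
    exact halfTrace_eq_of_zpowers_eq _ (d.σ ℓ) (d'.σ ℓ) hh0
      (hh ▸ orderOf_σ_eq_succ_of_prime W hK hodd h3 hℓ hinert d)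
      (hh ▸ orderOf_σ_eq_succ_of_prime W hK hodd h3 hℓ hinert d') hz d.y
  rw [hA]
  -- transversals matched through `G_ℓ = ⟨σ_ℓ⟩`
  have hσA := pointGalHom_σ_halfTrace_eq_neg W hCM hK hodd h3 hH hℓK hℓF d
  have hG : ringClassGalOver ι ℓ 1 = Subgroup.zpowers (d.σ ℓ) := by
    rw [d.zpowers_σ ℓ hℓℓ, Nat.div_self hℓ.pos]
  have hfin : IsOfFinOrder (d.σ ℓ) :=
    orderOf_pos_iff.mp (by rw [orderOf_σ_eq_succ_of_prime W hK hodd h3 hℓ hinert d]; omega)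
  exact two_dvd_sum_transversal_iff _ (ringClassGal ι ℓ) (d.σ ℓ) hfin _ hσA d.S d'.S d.S_subset d'.S_subset
    (fun g hg ↦ by simpa only [hG] using d.S_transversal g hg)
    (fun g hg ↦ by simpa only [hG] using d'.S_transversal g hg)

/-- **At prime level the stub's `∃ d` may be read `∀ d`.** Same standing hypotheses, any conductor-`1` datum `d₁` on
the frame (so that data of conductor `ℓ` exist, `nonempty_kolyvaginHeegnerData_of_kolyvaginPrimes`):
`(∃ d, P_d(ℓ) ∉ 2E(K[ℓ])) ⟺ (∀ d, P_d(ℓ) ∉ 2E(K[ℓ]))`. [cite: GrossLMS1991, §4 (4.1)] -/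
theorem exists_iff_forall_primitive_prime (W : WeierstrassCurve ℚ) [W.IsElliptic] [W.IsGloballyMinimal]
    [NeZero (W.conductorNorm ℤ)] (hCM : W.HasCM) (hK : IsImaginaryQuadratic K)
    (hodd : Odd (NumberField.discr K)) (h3 : NumberField.discr K ≠ -3)
    (hH : SatisfiesHeegnerHypothesis (W.conductorNorm ℤ) K)
    {Dt : ModularParametrizationData W (W.conductorNorm ℤ)} {β : ℤ} {ι : K →+* ℂ}
    (d₁ : KolyvaginHeegnerData Dt β ι 1) {ℓ : ℕ}
    (hℓK : Zhang2014.IsKolyvaginPrime (W.conductorNorm ℤ) W K 2 ℓ) (hℓF : CMInert W ℓ) :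
    (∃ d : KolyvaginHeegnerData Dt β ι ℓ,
        ¬ ∃ Q : (W.baseChange (ringClassField K ι ℓ)).toAffine.Point, (2 : ℤ) • Q = d.derivedPoint) ↔
      ∀ d : KolyvaginHeegnerData Dt β ι ℓ,
        ¬ ∃ Q : (W.baseChange (ringClassField K ι ℓ)).toAffine.Point, (2 : ℤ) • Q = d.derivedPoint := by
  refine ⟨fun ⟨d, hd⟩ d' h' ↦ hd ((two_dvd_derivedPoint_iff_of_data W hCM hK hodd h3 hH hℓK hℓF d' d).mp h'),
    fun h ↦ ?_⟩
  have hKol : ∀ q ∈ ℓ.primeFactors, Zhang2014.IsKolyvaginPrime (W.conductorNorm ℤ) W K 2 q := fun q hq ↦ by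
    rw [hℓK.1.primeFactors, Finset.mem_singleton] at hq
    rw [hq]
    exact hℓK
  obtain ⟨d⟩ := nonempty_kolyvaginHeegnerData_of_kolyvaginPrimes W hK hH Dt ι d₁ hℓK.1.squarefree hKol
  exact ⟨d, h d⟩

end Heegner

end Summit.BirchSwinnertonDyer.BirchSwinnertonDyer.Theorems.CMKolyvaginConjecturePositiveDepth

end
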